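import Summits.CriticalPhenomena.PercolationContinuityZ3.Theorems.Transplant.PlanarCells2Contain
import HarnessLib

/-!
# Two-unit planar cells `PCells2` (layer L1′ of route D″ v2), part 3: disjointness of cubes / between-boxes / far regions / cells / zones /
# far rows (wide and narrow), the column facts, self-adjacency, and the reversed between-boxes

builds on p205010 (kernel theorem, internal audit signed; external expert review pending) — nothing in this file uses p205010.
Lane `prim-bschramm`, seat `prim-hp-8` (gen 28; `HOME/bschramm/DPRIME-SCOPE.md` §2 L1′ + addendum B, lead VERDICT V98, design-owner
ruling R2: namespace `PCells2`, names as in `PCells`, cell parameter `P`); helper file (`--supports stmt-CriticalPhenomena-4575 --as helper`).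
Continues `PlanarCells2Defs` / `PlanarCells2Contain`; every proof is the one-unit proof of `PlanarCellsSep` / `PlanarCellsNarrowDefs` /
`PlanarCellsPSep2` read coordinatewise: a comparison along axis `i` uses the unit `r i` only (the one-dimensional lemmas `PCells.oneD_*`
are parameter-free in the unit `R`, so they serve both axes).
* `Q_disjoint_Q`, `Q_disjoint_Btw`, `Q_disjoint_Efar`, `Btw_disjoint_Efar`, `Ewv_disjoint_Efar`, `Btw_disjoint_Btw`, `Cell_disjoint_Q`,
  `Zone_disjoint_Q`; narrow: `Q_disjoint_BtwN`, `Q_disjoint_EfarN`, `EfarN_disjoint_Q`, `BtwN_disjoint_EfarN`, `EwvN_disjoint_EfarN`,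
  `BtwN_disjoint_BtwN`, `farAN_disjoint_Stub`, `farAN_disjoint_Q`;
* the column facts `cen_not_mem_Cell`, `cen_not_mem_Zone`;
* self-adjacency `exists_adj_of_mem_Q / _Btw / _Stub / _BtwN`; the reversed boxes `Btw_rev'`, `BtwN_rev'`.
[cite: KozmaNitzan2024, §4 pp. 25–26 (Q_v, M_v, E_{v,x}, H^j_{v,x}) — the ℤ^d model, one unit]
-/

noncomputable section

namespace Summit.CriticalPhenomena.PercolationContinuityZ3.Theorems

namespace Transplant

open Literature.Probability.Percolation Literature.Probability.LatticeModels SimpleGraph GadgetSystem Contour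
open Literature.Probability.Percolation.KozmaNitzan
open Literature.Probability.Percolation.KozmaNitzan.Cells (oth oth_ne sgOf sgOf_sign stepVec_apply_fst stepVec_apply_oth eq_oth_of_ne oth_oth
  eq_of_coords)
open PCells (mem_psBox_iff oneD_sq_sq oneD_sq_btw oneD_btw_btw exists_adj_of_mem_Icc)

namespace PCells2

variable (P : PCells2)

/-! ## Disjointness (wide boxes) -/

/-- Distinct macro-vertices have disjoint cubes. [folklore] -/
theorem Q_disjoint_Q {u x : Site 2} (h : u ≠ x) : Disjoint (P.Q u : Finset (Site 2)) (P.Q x) := by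
  rw [Finset.disjoint_left]
  intro t htu htx
  rw [Q, mem_abox_iff] at htu htx
  apply h
  funext i
  have h1 := htu i; have h2 := htx i
  push_cast at h1 h2
  have hr : (1 : ℤ) ≤ P.r i := by exact_mod_cast P.one_le_r i
  exact oneD_sq_sq hr (w := 5 * P.r i) (w' := 5 * P.r i) (by omega) (by simpa using h1) (by simpa using h2)

/-- Cubes and between-boxes are disjoint. [folklore] -/
theorem Q_disjoint_Btw (x v : Site 2) (δ : MDir) : Disjoint (P.Q x : Finset (Site 2)) (P.Btw v δ) := by
  rw [Finset.disjoint_left]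
  intro t htQ htB
  rw [Q, mem_abox_iff] at htQ
  rw [Btw, mem_psBox_iff] at htB
  obtain ⟨⟨h1, h2⟩, -, -⟩ := htB
  have ha := htQ δ.1
  push_cast at ha h1 h2
  have hr : (1 : ℤ) ≤ P.r δ.1 := by exact_mod_cast P.one_le_r δ.1
  exact oneD_sq_btw hr (sgOf_sign δ) (m := x δ.1) (n := v δ.1) (by simpa using ha) (by simpa using And.intro h1 h2)

/-- A cube misses the far region of its own macro-vertex. [folklore] -/
theorem Q_disjoint_Efar (v : Site 2) (δ : MDir) : Disjoint (P.Q v : Finset (Site 2)) (P.Efar v δ) := by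
  rw [Finset.disjoint_left]
  intro t htQ htE
  rw [Q, mem_abox_iff] at htQ
  rw [Efar, mem_psBox_iff] at htE
  obtain ⟨⟨h1, -⟩, -, -⟩ := htE
  have ha := htQ δ.1
  push_cast at ha h1
  rcases sgOf_sign δ with hs | hs <;> rw [hs] at h1 <;> omega

/-- Between-boxes of different directions at the same macro-vertex miss each other's far regions. [folklore] -/
theorem Btw_disjoint_Efar (v : Site 2) {δ δ' : MDir} (h : δ' ≠ δ) : Disjoint (P.Btw v δ') (P.Efar v δ) := by
  rw [Finset.disjoint_left]
  intro t htB htE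
  rw [Btw, mem_psBox_iff] at htB
  rw [Efar, mem_psBox_iff] at htE
  obtain ⟨⟨hb1, hb2⟩, hb3, hb4⟩ := htB
  obtain ⟨⟨he1, he2⟩, he3, he4⟩ := htE
  by_cases hax : δ'.1 = δ.1
  · -- same axis, opposite signs
    have hsg : sgOf δ' = -sgOf δ := by
      have hne : δ'.2 ≠ δ.2 := fun h2 => h (Prod.ext hax h2)
      unfold sgOf; rcases Bool.eq_false_or_eq_true δ.2 with hb | hb <;> simp_all
    rw [hax, hsg] at hb1
    rcases sgOf_sign δ with hs | hs <;> rw [hs] at hb1 he1 <;> omega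
  · -- different axes: the transverse coordinate of `Btw v δ'` (unit `r (oth δ'.1) = r δ.1`) is the axis of `Efar v δ`
    have hoth : δ.1 = oth δ'.1 := eq_oth_of_ne (Ne.symm hax)
    rw [← hoth] at hb3 hb4
    rcases sgOf_sign δ with hs | hs <;> rw [hs] at he1 <;> omega

/-- `E_{w,δw} = Btw ∪ Q_{w+δw}` misses the far regions of `w + δw` in every direction except back. [folklore] -/
theorem Ewv_disjoint_Efar (w : Site 2) {δw du : MDir} (h : du ≠ rev δw) :
    Disjoint (P.Ewv w δw) (P.Efar (w + stepVec δw) du) := by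
  rw [Ewv, Finset.disjoint_union_left]
  refine ⟨?_, P.Q_disjoint_Efar _ du⟩
  rw [Finset.disjoint_left]
  intro t htB htE
  rw [Btw, mem_psBox_iff] at htB
  rw [Efar, mem_psBox_iff] at htE
  obtain ⟨⟨hb1, hb2⟩, hb3, hb4⟩ := htB
  obtain ⟨⟨he1, he2⟩, he3, he4⟩ := htE
  have hf := P.cen_add_stepVec_fst w δw
  have ho := P.cen_add_stepVec_oth w δw
  by_cases hax : du.1 = δw.1
  · -- same axis: `du = δw` (not the reverse), so `Efar` points further out while `Btw` is behind `Q_{w+δw}`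
    have hsg : sgOf du = sgOf δw := by
      have h2 : du.2 = δw.2 := by
        by_contra hne
        apply h
        refine Prod.ext hax ?_
        change du.2 = !δw.2
        rcases Bool.eq_false_or_eq_true δw.2 with hb | hb <;> rcases Bool.eq_false_or_eq_true du.2 with hb' | hb' <;> simp_all
      unfold sgOf; rw [h2]
    rw [hax, hsg, hf] at he1
    have hr : (0 : ℤ) ≤ P.r δw.1 := by positivity
    rcases sgOf_sign δw with hs | hs <;> rw [hs] at hb2 he1 <;> nlinarith
  · have hoth : du.1 = oth δw.1 := eq_oth_of_ne hax
    rw [hoth, ho] at he1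
    rcases sgOf_sign du with hs | hs <;> rw [hs] at he1 <;> omega

/-- Between-boxes of different (undirected) macro-edges are disjoint. [folklore] -/
theorem Btw_disjoint_Btw {v v' : Site 2} {δ δ' : MDir} (h1 : (v', δ') ≠ (v, δ)) (h2 : (v', δ') ≠ (v + stepVec δ, rev δ)) :
    Disjoint (P.Btw v δ : Finset (Site 2)) (P.Btw v' δ') := by
  rw [Finset.disjoint_left]
  intro t ht ht'
  rw [Btw, mem_psBox_iff] at ht ht'
  obtain ⟨⟨ha1, ha2⟩, ha3, ha4⟩ := ht
  obtain ⟨⟨hb1, hb2⟩, hb3, hb4⟩ := ht'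
  by_cases hax : δ'.1 = δ.1
  · -- same axis: transverse coordinates force `v' (oth) = v (oth)`; along the axis the strips must coincide
    rw [hax] at hb1 hb2 hb3 hb4
    have hr : (1 : ℤ) ≤ P.r δ.1 := by exact_mod_cast P.one_le_r δ.1
    have hr' : (1 : ℤ) ≤ P.r (oth δ.1) := by exact_mod_cast P.one_le_r (oth δ.1)
    have hoth : v' (oth δ.1) = v (oth δ.1) :=
      oneD_sq_sq hr' (w := 5 * P.r (oth δ.1)) (w' := 5 * P.r (oth δ.1)) (by omega) (by simpa using And.intro hb3 hb4)
        (by simpa using And.intro ha3 ha4)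
    rcases oneD_btw_btw hr (sgOf_sign δ) (sgOf_sign δ') (n := v δ.1) (n' := v' δ.1) (t := t δ.1)
        (by simpa using And.intro ha1 ha2) (by simpa using And.intro hb1 hb2) with ⟨hn, hs⟩ | ⟨hn, hs⟩
    · apply h1
      have hδ : δ' = δ := by
        refine Prod.ext hax ?_
        have := hs; unfold sgOf at this
        rcases Bool.eq_false_or_eq_true δ.2 with hb | hb <;> rcases Bool.eq_false_or_eq_true δ'.2 with hb' | hb' <;> simp_all
      exact Prod.ext (eq_of_coords δ.1 hn.symm hoth) hδ
    · apply h2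
      have hδ : δ' = rev δ := by
        refine Prod.ext hax ?_
        change δ'.2 = !δ.2
        have := hs; unfold sgOf at this
        rcases Bool.eq_false_or_eq_true δ.2 with hb | hb <;> rcases Bool.eq_false_or_eq_true δ'.2 with hb' | hb' <;> simp_all
      refine Prod.ext (eq_of_coords δ.1 ?_ ?_) hδ
      · change v' δ.1 = (v + stepVec δ) δ.1
        rw [Pi.add_apply, stepVec_apply_fst]; exact hn
      · change v' (oth δ.1) = (v + stepVec δ) (oth δ.1)
        rw [Pi.add_apply, stepVec_apply_oth, add_zero]; exact hoth
  · -- different axes: the transverse coordinate of one is the axis of the other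
    have hoth : δ'.1 = oth δ.1 := eq_oth_of_ne hax
    rw [← hoth] at ha3 ha4
    have hr : (1 : ℤ) ≤ P.r δ'.1 := by exact_mod_cast P.one_le_r δ'.1
    exact oneD_sq_btw hr (sgOf_sign δ') (m := v δ'.1) (n := v' δ'.1) (by simpa using And.intro ha3 ha4) (by simpa using And.intro hb1 hb2)

/-- Cells miss the cubes of other macro-vertices. [folklore] -/
theorem Cell_disjoint_Q {u x : Site 2} (h : u ≠ x) : Disjoint (P.Cell u) (P.Q x) := by
  rw [Finset.disjoint_left]
  intro t htC htQ
  rw [Cell, mem_abox_iff] at htC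
  rw [Q, mem_abox_iff] at htQ
  apply h
  funext i
  have h1 := htC i; have h2 := htQ i
  push_cast at h1 h2
  have hr : (1 : ℤ) ≤ P.r i := by exact_mod_cast P.one_le_r i
  exact oneD_sq_sq hr (w := 10 * P.r i) (w' := 5 * P.r i) (by omega) (by simpa using h1) (by simpa using h2)

/-- Stub zones miss all cubes. [folklore] -/
theorem Zone_disjoint_Q (u : Site 2) (δ : MDir) (x : Site 2) : Disjoint (P.Zone u δ) (P.Q x) := by
  rw [Finset.disjoint_left]
  intro t htZ htQ
  rw [Zone, mem_psBox_iff] at htZ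
  rw [Q, mem_abox_iff] at htQ
  obtain ⟨⟨h1, h2⟩, -, -⟩ := htZ
  obtain ⟨ha1, ha2⟩ := htQ δ.1
  have hs20 : 20 * (P.s δ.1 : ℤ) ≤ P.r δ.1 := by exact_mod_cast P.twenty_mul_s_le_r δ.1
  have hs1 : (1 : ℤ) ≤ P.s δ.1 := by exact_mod_cast P.hs δ.1
  push_cast at ha1 ha2 h1 h2
  rcases lt_trichotomy (x δ.1) (u δ.1) with hlt | heq | hgt
  · have hg := P.cen_gap (u := x) (v := u) (i := δ.1) (by omega)
    rcases sgOf_sign δ with hs | hs <;> rw [hs] at h1 h2 <;> omega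
  · have hg := P.cen_congr (u := x) (v := u) (i := δ.1) heq
    rcases sgOf_sign δ with hs | hs <;> rw [hs] at h1 h2 <;> omega
  · have hg := P.cen_gap (u := u) (v := x) (i := δ.1) (by omega)
    rcases sgOf_sign δ with hs | hs <;> rw [hs] at h1 h2 <;> omega

/-! ## Disjointness (narrow boxes, inherited) -/

/-- Cubes and narrow between-boxes are disjoint. [folklore] -/
theorem Q_disjoint_BtwN (x v : Site 2) (δ : MDir) : Disjoint (P.Q x : Finset (Site 2)) (P.BtwN v δ) :=
  (P.Q_disjoint_Btw x v δ).mono le_rfl (P.BtwN_subset_Btw v δ)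

/-- A cube misses the narrow far region of its own macro-vertex. [folklore] -/
theorem Q_disjoint_EfarN (v : Site 2) (δ : MDir) : Disjoint (P.Q v : Finset (Site 2)) (P.EfarN v δ) :=
  (P.Q_disjoint_Efar v δ).mono le_rfl (P.EfarN_subset_Efar v δ)

/-- `EfarN` misses the cube `Q x` (the same fact, stated from the far side). [folklore] -/
theorem EfarN_disjoint_Q (x : Site 2) (du : MDir) : Disjoint (P.EfarN x du) (P.Q x) :=
  (P.Q_disjoint_EfarN x du).symm

/-- Narrow between-boxes of other directions at the same macro-vertex miss the narrow far region. [folklore] -/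
theorem BtwN_disjoint_EfarN (v : Site 2) {δ δ' : MDir} (h : δ' ≠ δ) : Disjoint (P.BtwN v δ') (P.EfarN v δ) :=
  (P.Btw_disjoint_Efar v h).mono (P.BtwN_subset_Btw v δ') (P.EfarN_subset_Efar v δ)

/-- `EwvN_{w,δw}` misses the narrow far regions of `w + δw` in every direction except back. [folklore] -/
theorem EwvN_disjoint_EfarN (w : Site 2) {δw du : MDir} (h : du ≠ rev δw) :
    Disjoint (P.EwvN w δw) (P.EfarN (w + stepVec δw) du) :=
  (P.Ewv_disjoint_Efar w h).mono (P.EwvN_subset_Ewv w δw) (P.EfarN_subset_Efar _ du)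

/-- Narrow between-boxes of different (undirected) macro-edges are disjoint. [folklore] -/
theorem BtwN_disjoint_BtwN {v v' : Site 2} {δ δ' : MDir} (h1 : (v', δ') ≠ (v, δ)) (h2 : (v', δ') ≠ (v + stepVec δ, rev δ)) :
    Disjoint (P.BtwN v δ : Finset (Site 2)) (P.BtwN v' δ') :=
  (P.Btw_disjoint_Btw h1 h2).mono (P.BtwN_subset_Btw v δ) (P.BtwN_subset_Btw v' δ')

/-- `farAN` misses the stub of level `j`. [folklore] -/
theorem farAN_disjoint_Stub (x : Site 2) (du : MDir) (j : ℕ) : Disjoint (P.farAN x du j) (P.Stub x du j) := by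
  rw [Finset.disjoint_left]
  intro t ht ht'
  rw [farAN, mem_psBox_iff] at ht
  rw [Stub, mem_psBox_iff] at ht'
  omega

/-- `farAN` misses the cube `Q x`. [folklore] -/
theorem farAN_disjoint_Q (x : Site 2) (du : MDir) (j : ℕ) : Disjoint (P.farAN x du j) (P.Q x) :=
  (P.EfarN_disjoint_Q x du).mono (P.farAN_subset_EfarN x du j) le_rfl

/-- `farAS` misses the stub of level `j`. [folklore] -/
theorem farAS_disjoint_Stub (x : Site 2) (du : MDir) (j : ℕ) : Disjoint (P.farAS x du j) (P.Stub x du j) :=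
  (P.farAN_disjoint_Stub x du j).mono (P.farAS_subset_farAN x du j) le_rfl

/-- `farAS` misses the cube `Q x`. [folklore] -/
theorem farAS_disjoint_Q (x : Site 2) (du : MDir) (j : ℕ) : Disjoint (P.farAS x du j) (P.Q x) :=
  (P.farAN_disjoint_Q x du j).mono (P.farAS_subset_farAN x du j) le_rfl

/-! ## The column of a macro-vertex: its centre -/

/-- The centre of `x` is not in the cell of another macro-vertex. [folklore] -/
theorem cen_not_mem_Cell {u x : Site 2} (h : u ≠ x) : P.cen x ∉ P.Cell u := fun hc =>
  Finset.disjoint_left.1 (P.Cell_disjoint_Q h) hc (P.cen_mem_Q x)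

/-- The centre of `x` is in no stub zone. [folklore] -/
theorem cen_not_mem_Zone (u : Site 2) (δ : MDir) (x : Site 2) : P.cen x ∉ (P.Zone u δ : Finset (Site 2)) := fun hz =>
  Finset.disjoint_left.1 (P.Zone_disjoint_Q u δ x) hz (P.cen_mem_Q x)

/-! ## Self-adjacency: every vertex of a box has a lattice neighbour in the box -/

/-- Self-adjacency of `Q_v`. [folklore] -/
theorem exists_adj_of_mem_Q (v : Site 2) {t : Site 2} (ht : t ∈ P.Q v) : ∃ t' ∈ P.Q v, (zdGraph 2).Adj t t' :=
  exists_adj_of_mem_Icc 0 (by simp only [Pi.sub_apply, Pi.add_apply, hw_apply]; push_cast; have := P.one_le_r 0; omega) ht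

/-- Self-adjacency of `Btw` (a signed box is an `Icc`; its transverse side has length `10r⊥ ≥ 1`). [folklore] -/
theorem exists_adj_of_mem_Btw (v : Site 2) (δ : MDir) {t : Site 2} (ht : t ∈ P.Btw v δ) : ∃ t' ∈ P.Btw v δ, (zdGraph 2).Adj t t' := by
  unfold Btw sBox at ht ⊢
  refine exists_adj_of_mem_Icc (oth δ.1) ?_ ht
  simp only [sLo, sHi, if_neg (oth_ne δ.1)]
  have := P.one_le_r (oth δ.1); omega

/-- Self-adjacency of the stubs. [folklore] -/
theorem exists_adj_of_mem_Stub (v : Site 2) (δ : MDir) (j : ℕ) {t : Site 2} (ht : t ∈ P.Stub v δ j) :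
    ∃ t' ∈ P.Stub v δ j, (zdGraph 2).Adj t t' := by
  unfold Stub sBox at ht ⊢
  refine exists_adj_of_mem_Icc (oth δ.1) ?_ ht
  simp only [sLo, sHi, if_neg (oth_ne δ.1)]
  have := P.one_le_r (oth δ.1); omega

/-- Self-adjacency of `BtwN` (its transverse side has length `2(5r⊥ − 1) ≥ 1`). [folklore] -/
theorem exists_adj_of_mem_BtwN (v : Site 2) (δ : MDir) {t : Site 2} (ht : t ∈ P.BtwN v δ) : ∃ t' ∈ P.BtwN v δ, (zdGraph 2).Adj t t' := by
  unfold BtwN sBox at ht ⊢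
  refine exists_adj_of_mem_Icc (oth δ.1) ?_ ht
  simp only [sLo, sHi, if_neg (oth_ne δ.1)]
  have := P.one_le_r (oth δ.1); omega

/-- Self-adjacency of the full corridor. [folklore] -/
theorem exists_adj_of_mem_Hfull (v : Site 2) (δ : MDir) {t : Site 2} (ht : t ∈ P.Hfull v δ) : ∃ t' ∈ P.Hfull v δ, (zdGraph 2).Adj t t' := by
  unfold Hfull sBox at ht ⊢
  refine exists_adj_of_mem_Icc (oth δ.1) ?_ ht
  simp only [sLo, sHi, if_neg (oth_ne δ.1)]
  have := P.one_le_r (oth δ.1); omega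

/-! ## The reversed between-boxes -/

/-- **The between-box of a directed macro-edge equals that of the reversed edge** (planar, two units). [folklore] -/
theorem Btw_rev' (v : Site 2) (δ : MDir) : (P.Btw (v + stepVec δ) (rev δ) : Finset (Site 2)) = P.Btw v δ := by
  ext t
  have hax : (rev δ).1 = δ.1 := rfl
  rw [Btw, Btw, mem_psBox_iff, mem_psBox_iff, hax, Cells.sgOf_rev, P.cen_add_stepVec_fst, P.cen_add_stepVec_oth]
  rcases sgOf_sign δ with hs | hs <;> rw [hs] <;> constructor <;> rintro ⟨⟨h1, h2⟩, h3, h4⟩ <;>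
    exact ⟨⟨by omega, by omega⟩, h3, h4⟩

/-- **The narrow between-box of a directed macro-edge equals that of the reversed edge.** [folklore] -/
theorem BtwN_rev' (v : Site 2) (δ : MDir) : (P.BtwN (v + stepVec δ) (rev δ) : Finset (Site 2)) = P.BtwN v δ := by
  ext t
  have hax : (rev δ).1 = δ.1 := rfl
  rw [BtwN, BtwN, mem_psBox_iff, mem_psBox_iff, hax, Cells.sgOf_rev, P.cen_add_stepVec_fst, P.cen_add_stepVec_oth]
  rcases sgOf_sign δ with hs | hs <;> rw [hs] <;> constructor <;> rintro ⟨⟨h1, h2⟩, h3, h4⟩ <;>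
    exact ⟨⟨by omega, by omega⟩, h3, h4⟩

/-- `EwvN` of a directed macro-edge and of the reversed edge cover the same narrow between-box: `EwvN (v+δ) (rev δ) = BtwN v δ ∪ Q v`.
[folklore] -/
theorem EwvN_rev' (v : Site 2) (δ : MDir) : (P.EwvN (v + stepVec δ) (rev δ) : Finset (Site 2)) = P.BtwN v δ ∪ P.Q v := by
  rw [EwvN, BtwN_rev', stepVec_rev, add_neg_cancel_right]

end PCells2

end Transplant

end Summit.CriticalPhenomena.PercolationContinuityZ3.Theorems

end
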